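import Literature.MathematicalPhysics.QuantumFieldTheory.SU2OneLinkMoments
import Literature.MathematicalPhysics.QuantumFieldTheory.SU2WilsonCharacterCoefficients
import Literature.MathematicalPhysics.QuantumFieldTheory.StrongCouplingActivities
import Literature.MathematicalPhysics.QuantumLattice.SU2Haar
import Literature.MathematicalPhysics.QuantumLattice.GaugeGroups
import HarnessLib

/-!
# Crux `UVSeamRec` (stmt-QuantumFields-20043): the ONE-LINK THERMAL FLOOR of a plaquette for `SU(2)` —
# `E_ν[2 − Re tr(gW)] ≥ 6/(4B+3)` under every one-link law `ν ∝ e^{B Re tr(gV)} dg`, for EVERY `W ∈ SU(2)`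

Helper file (`--supports stmt-QuantumFields-20043`) of the LEAD seat `ym-spine-20043-p1` (gen 10), part 1 of the «thermal floor» pair.
PURPOSE.  The LEAD's fixed-scale classical split (p590468 `pureSplit_fixedScale`) uses the TRIVIAL reference value `p ≡ N`; the sequel shows
that this reference cannot carry tempered-d1's flag-free split `PureSplitCl` along the record's scale window, because NO exterior — in particular
the identity exterior of the Dirichlet rate law (tempered-d1 `DirichletRate`) — can freeze the centre plaquette of a cube faster than `1/β`.  The
microscopic input is proved here, in the one-link currency of the tree (`SU2OneLink`, Montvay–Münster §3.2.3):

* §1 `SU(2)` algebra: `Re tr X⁻¹ = Re tr X`, `M + M⁻¹ = (Re tr M)·1` (Cayley–Hamilton on `SU(2)`), hence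
  `Re tr(gM) + Re tr(gM⁻¹) = Re tr M · Re tr g`;
* §2 one-link integrals against the class weight `e^{B Re tr g}` on the Haar probability measure `σ` of `SU(2)`:
  `integral_re_trace_mul_exp_nonneg` (`∫ Re tr g · e^{B Re tr g} dσ ≥ 0` for `B ≥ 0`: the tree's `2I₂(2B)/B`, and `0` at `B = 0` by character
  orthogonality), the REDUCTION `∫ Re tr(gM) e^{B Re tr g} dσ = (Re tr M / 2)·∫ Re tr g e^{B Re tr g} dσ` (inversion invariance of `σ` turns `M` into
  `M⁻¹`; average the two and use §1), and the **plaquette floor of the one-link law**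
  `integral_two_sub_re_trace_mul_mul_exp_ge`: for all `B ≥ 0` and ALL `V, W ∈ SU(2)`,
  `(6/(4B+3))·∫ e^{B Re tr(gV)} dσ ≤ ∫ (2 − Re tr(gW)) e^{B Re tr(gV)} dσ`
  — right translation by `V⁻¹`, the reduction with `M = V⁻¹W` (`Re tr M ≤ 2`), and the tree's first-moment floor
  `6·∫e^{B Re tr} ≤ (4B+3)·∫(2 − Re tr)e^{B Re tr}` (`SU2OneLink.mul_integral_exp_le_integral_two_sub_re_trace_mul_exp`).

HONEST FRAMING.  Folklore one-link (Creutz heat-bath) algebra for `SU(2)`; constants not sharp (`3/(2B)` asymptotically); nothing of E0′, NT or the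
gap; not Clay.
-/

set_option autoImplicit false

noncomputable section

open scoped Matrix
open MeasureTheory
open Literature.MathematicalPhysics.QuantumFieldTheory (haarProbability)
open Literature.MathematicalPhysics.QuantumFieldTheory.SU2OneLink
open Literature.MathematicalPhysics.QuantumLattice (su2Quat quatMatrix_su2Quat normSq_su2Quat su2_apply_10 su2_apply_11)

namespace Summit.QuantumFields.YangMills.Cruxes.UVSeamRec.ClassicalResponse.ThermalFloor

/-! ## §1 `SU(2)` algebra: inverse traces and Cayley–Hamilton -/

/-- The inverse in `SU(2)` is the conjugate transpose (Mathlib: `A⁻¹ := star A`). [folklore] -/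
theorem coe_inv_eq_conjTranspose (X : (Matrix.specialUnitaryGroup (Fin 2) ℂ)) : (X⁻¹).1 = X.1ᴴ := rfl

/-- `Re tr X⁻¹ = Re tr X` on `SU(2)` (`X⁻¹ = X†`). [folklore] -/
theorem re_trace_coe_inv (X : (Matrix.specialUnitaryGroup (Fin 2) ℂ)) : ((X⁻¹).1.trace).re = (X.1.trace).re := by
  rw [coe_inv_eq_conjTranspose, Matrix.trace_conjTranspose, Complex.star_def, Complex.conj_re]

/-- `Re tr(g⁻¹ M) = Re tr(g M⁻¹)` for `g, M ∈ SU(2)` (invert inside the trace, then cyclicity). [folklore] -/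
theorem re_trace_inv_mul (g M : (Matrix.specialUnitaryGroup (Fin 2) ℂ)) :
    (((g⁻¹).1 * M.1).trace).re = ((g.1 * (M⁻¹).1).trace).re := by
  have h1 : ((g⁻¹).1 * M.1) = (g⁻¹ * M).1 := (Submonoid.coe_mul _ _ _).symm
  have h2 : ((g⁻¹ * M : (Matrix.specialUnitaryGroup (Fin 2) ℂ)))⁻¹ = M⁻¹ * g := by rw [mul_inv_rev, inv_inv]
  rw [h1, ← re_trace_coe_inv (g⁻¹ * M), h2, Submonoid.coe_mul, Matrix.trace_mul_comm]

/-- The real part of the trace of `M ∈ SU(2)` is twice the real part of its `(0,0)` entry (`M₁₁ = conj M₀₀`). [folklore] -/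
theorem re_trace_eq_two_mul (M : (Matrix.specialUnitaryGroup (Fin 2) ℂ)) : (M.1.trace).re = 2 * (M.1 0 0).re := by
  rw [Matrix.trace_fin_two, su2_apply_11 M, Complex.add_re, Complex.conj_re]
  ring

/-- **Cayley–Hamilton on `SU(2)`**: `M + M⁻¹ = (Re tr M)·1` (the second row of `M` is determined by the first, tree `su2_apply_10/11`;
`tr M = M₀₀ + conj M₀₀` is real). [folklore] -/
theorem coe_add_coe_inv (M : (Matrix.specialUnitaryGroup (Fin 2) ℂ)) :
    M.1 + (M⁻¹).1 = (((M.1.trace).re : ℝ) : ℂ) • (1 : Matrix (Fin 2) (Fin 2) ℂ) := by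
  have h10 := su2_apply_10 M
  have h11 := su2_apply_11 M
  rw [coe_inv_eq_conjTranspose, re_trace_eq_two_mul]
  ext i j
  fin_cases i <;> fin_cases j
  · simp only [Matrix.add_apply, Matrix.conjTranspose_apply, Matrix.smul_apply, Matrix.one_apply_eq, smul_eq_mul, mul_one,
      Fin.zero_eta, Fin.isValue, Complex.star_def]
    apply Complex.ext
    · simp; ring
    · simp
  · simp only [Matrix.add_apply, Matrix.conjTranspose_apply, Matrix.smul_apply, Fin.zero_eta, Fin.isValue, Fin.mk_one,
      Matrix.one_apply_ne (show (0 : Fin 2) ≠ 1 by decide), smul_zero, h10, Complex.star_def, map_neg, Complex.conj_conj,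
      add_neg_cancel]
  · simp only [Matrix.add_apply, Matrix.conjTranspose_apply, Matrix.smul_apply, Fin.zero_eta, Fin.isValue, Fin.mk_one,
      Matrix.one_apply_ne (show (1 : Fin 2) ≠ 0 by decide), smul_zero, h10, Complex.star_def, neg_add_cancel]
  · simp only [Matrix.add_apply, Matrix.conjTranspose_apply, Matrix.smul_apply, Matrix.one_apply_eq, smul_eq_mul, mul_one,
      Fin.isValue, Fin.mk_one, h11, Complex.star_def, Complex.conj_conj]
    apply Complex.ext
    · simp; ring
    · simp

/-- `Re tr(gM) + Re tr(gM⁻¹) = Re tr M · Re tr g` for `g, M ∈ SU(2)`. [folklore] -/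
theorem re_trace_mul_add_re_trace_mul_inv (g M : (Matrix.specialUnitaryGroup (Fin 2) ℂ)) :
    ((g.1 * M.1).trace).re + ((g.1 * (M⁻¹).1).trace).re =
      (M.1.trace).re * (g.1.trace).re := by
  rw [← Complex.add_re, ← Matrix.trace_add, ← Matrix.mul_add, coe_add_coe_inv, Matrix.mul_smul, Matrix.mul_one,
    Matrix.trace_smul, smul_eq_mul, Complex.re_ofReal_mul]

/-- `Re tr M = 2·re(su2Quat M)` (quaternion model of `SU(2)`). [folklore] -/
theorem re_trace_eq_two_mul_re_su2Quat (M : (Matrix.specialUnitaryGroup (Fin 2) ℂ)) : (M.1.trace).re = 2 * (su2Quat M).re := by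
  rw [re_trace_eq_two_mul]; rfl

/-- `Re tr M ≤ 2` on `SU(2)` (`re(su2Quat M) ≤ 1` on the unit sphere). [folklore] -/
theorem re_trace_le_two (M : (Matrix.specialUnitaryGroup (Fin 2) ℂ)) : (M.1.trace).re ≤ 2 := by
  rw [re_trace_eq_two_mul_re_su2Quat]
  have h := normSq_su2Quat M
  rw [Quaternion.normSq_def'] at h
  nlinarith [sq_nonneg ((su2Quat M).re - 1), sq_nonneg (su2Quat M).imI, sq_nonneg (su2Quat M).imJ, sq_nonneg (su2Quat M).imK]

/-! ## §2 One-link integrals against the class weight `e^{B Re tr g}` -/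

/-- Continuous real functions on `SU(2)` are `σ`-integrable. [folklore] -/
theorem integrable_of_continuous_su2 {f : (Matrix.specialUnitaryGroup (Fin 2) ℂ) → ℝ} (hf : Continuous f) :
    Integrable f (haarProbability (Matrix.specialUnitaryGroup (Fin 2) ℂ)) := by
  obtain ⟨C, hC⟩ := (isCompact_univ.image hf).isBounded.exists_norm_le
  refine Integrable.of_mem_Icc (-C) C hf.measurable.aemeasurable (ae_of_all _ fun x => abs_le.1 ?_)
  rw [← Real.norm_eq_abs]
  exact hC _ (Set.mem_image_of_mem _ (Set.mem_univ x))

/-- `g ↦ Re tr(g A)` is continuous for every fixed matrix `A`. [folklore] -/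
theorem continuous_re_trace_mul (A : Matrix (Fin 2) (Fin 2) ℂ) : Continuous fun g : (Matrix.specialUnitaryGroup (Fin 2) ℂ) => ((g.1 * A).trace).re :=
  Complex.continuous_re.comp ((continuous_subtype_val.matrix_mul continuous_const).matrix_trace)

/-- **`∫ Re tr g · e^{B Re tr g} dσ ≥ 0` for `B ≥ 0`** (`= 2I₂(2B)/B > 0` for `B > 0` by the tree's Bessel evaluation; `= 0` at `B = 0` by
character orthogonality, `U₁(½Re tr) = Re tr`). [folklore] -/
theorem integral_re_trace_mul_exp_nonneg {B : ℝ} (hB : 0 ≤ B) :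
    0 ≤ ∫ g, (g.1.trace).re * Real.exp (B * (g.1.trace).re) ∂(haarProbability (Matrix.specialUnitaryGroup (Fin 2) ℂ)) := by
  rcases hB.eq_or_lt with rfl | hB'
  · have h := integral_chebyshevU_re_trace 1
    simp only [one_ne_zero, if_false, Nat.cast_one, Polynomial.Chebyshev.U_one, Polynomial.eval_mul, Polynomial.eval_ofNat,
      Polynomial.eval_X] at h
    have h' : ∫ g, (g.1.trace).re ∂(haarProbability (Matrix.specialUnitaryGroup (Fin 2) ℂ)) = 0 := by
      have : (fun g : (Matrix.specialUnitaryGroup (Fin 2) ℂ) => (g.1.trace).re) = fun g : (Matrix.specialUnitaryGroup (Fin 2) ℂ) => 2 * ((g.1.trace).re / 2) := by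
        funext g; ring
      rw [this, h]
    simp only [zero_mul, Real.exp_zero, mul_one, h']
    exact le_rfl
  · rw [integral_re_trace_mul_exp_eq_besselI B hB'.ne']
    have h2 : 0 < Literature.Analysis.FunctionSpaces.besselI 2 (2 * B) := by
      rw [Literature.Analysis.FunctionSpaces.besselI_eq_latticeModels_besselI]
      exact Literature.Probability.LatticeModels.besselI_pos (by positivity) _
    positivity

/-- **The reduction**: `∫ Re tr(gM) e^{B Re tr g} dσ = (Re tr M / 2) · ∫ Re tr g · e^{B Re tr g} dσ` for `M ∈ SU(2)` (inversion invariance of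
`σ` and `Re tr(g⁻¹M) = Re tr(gM⁻¹)`, `Re tr g⁻¹ = Re tr g` give `∫ Re tr(gM)e = ∫ Re tr(gM⁻¹)e`; add and use `M + M⁻¹ = Re tr M · 1`). [folklore] -/
theorem integral_re_trace_mul_coe_mul_exp (M : (Matrix.specialUnitaryGroup (Fin 2) ℂ)) (B : ℝ) :
    ∫ g, ((g.1 * M.1).trace).re * Real.exp (B * (g.1.trace).re) ∂(haarProbability (Matrix.specialUnitaryGroup (Fin 2) ℂ)) =
      (M.1.trace).re / 2 * ∫ g, (g.1.trace).re * Real.exp (B * (g.1.trace).re) ∂(haarProbability (Matrix.specialUnitaryGroup (Fin 2) ℂ)) := by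
  set f : (Matrix.specialUnitaryGroup (Fin 2) ℂ) → ℝ := fun g => ((g.1 * M.1).trace).re * Real.exp (B * (g.1.trace).re) with hf
  set f' : (Matrix.specialUnitaryGroup (Fin 2) ℂ) → ℝ := fun g => ((g.1 * (M⁻¹).1).trace).re * Real.exp (B * (g.1.trace).re) with hf'
  have hinv : ∫ g, f g ∂(haarProbability (Matrix.specialUnitaryGroup (Fin 2) ℂ)) = ∫ g, f' g ∂(haarProbability (Matrix.specialUnitaryGroup (Fin 2) ℂ)) := by
    rw [← integral_inv_eq_self f (haarProbability (Matrix.specialUnitaryGroup (Fin 2) ℂ))]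
    refine integral_congr_ae (ae_of_all _ fun g => ?_)
    simp only [hf, hf', re_trace_inv_mul, re_trace_coe_inv]
  have hfi : Integrable f (haarProbability (Matrix.specialUnitaryGroup (Fin 2) ℂ)) :=
    integrable_of_continuous_su2 ((continuous_re_trace_mul _).mul
      (Real.continuous_exp.comp (continuous_const.mul continuous_re_trace)))
  have hfi' : Integrable f' (haarProbability (Matrix.specialUnitaryGroup (Fin 2) ℂ)) :=
    integrable_of_continuous_su2 ((continuous_re_trace_mul _).mul
      (Real.continuous_exp.comp (continuous_const.mul continuous_re_trace)))
  have hsum : ∫ g, f g ∂(haarProbability (Matrix.specialUnitaryGroup (Fin 2) ℂ)) + ∫ g, f' g ∂(haarProbability (Matrix.specialUnitaryGroup (Fin 2) ℂ)) =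
      (M.1.trace).re * ∫ g, (g.1.trace).re * Real.exp (B * (g.1.trace).re) ∂(haarProbability (Matrix.specialUnitaryGroup (Fin 2) ℂ)) := by
    rw [← integral_add hfi hfi', ← integral_const_mul]
    refine integral_congr_ae (ae_of_all _ fun g => ?_)
    simp only [hf, hf']
    rw [← add_mul, re_trace_mul_add_re_trace_mul_inv]
    ring
  have : ∫ g, f g ∂(haarProbability (Matrix.specialUnitaryGroup (Fin 2) ℂ)) =
      (M.1.trace).re / 2 * ∫ g, (g.1.trace).re * Real.exp (B * (g.1.trace).re) ∂(haarProbability (Matrix.specialUnitaryGroup (Fin 2) ℂ)) := by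
    linarith
  simpa only [hf] using this

/-- **PLAQUETTE FLOOR OF THE ONE-LINK LAW.**  For `B ≥ 0` and ALL `V, W ∈ SU(2)`:
`(6/(4B+3)) · ∫ e^{B Re tr(gV)} dσ ≤ ∫ (2 − Re tr(gW)) e^{B Re tr(gV)} dσ`
— under the one-link law `∝ e^{B Re tr(gV)} dσ` (staples aligned along `V`, total weight `B`) the mean deficit of ANY plaquette through the
link, `2 − Re tr(gW)`, is at least the tree's axis floor `6/(4B+3)` (`≈ 3/(2B)`).  Proof: right translation `g ↦ gV⁻¹`, the reduction with
`M = V⁻¹W` (`Re tr M ≤ 2`, `∫ Re tr g e^{B Re tr g} ≥ 0`), then `SU2OneLink.mul_integral_exp_le_integral_two_sub_re_trace_mul_exp`. [folklore] -/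
theorem integral_two_sub_re_trace_mul_mul_exp_ge {B : ℝ} (hB : 0 ≤ B) (V W : (Matrix.specialUnitaryGroup (Fin 2) ℂ)) :
    6 / (4 * B + 3) * ∫ g, Real.exp (B * ((g.1 * V.1).trace).re) ∂(haarProbability (Matrix.specialUnitaryGroup (Fin 2) ℂ)) ≤
      ∫ g, (2 - ((g.1 * W.1).trace).re) * Real.exp (B * ((g.1 * V.1).trace).re) ∂(haarProbability (Matrix.specialUnitaryGroup (Fin 2) ℂ)) := by
  -- right translation by `V⁻¹` (`haarProbability.instIsMulRightInvariant`)
  have hZ : ∫ g, Real.exp (B * ((g.1 * V.1).trace).re) ∂(haarProbability (Matrix.specialUnitaryGroup (Fin 2) ℂ)) =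
      ∫ g, Real.exp (B * (g.1.trace).re) ∂(haarProbability (Matrix.specialUnitaryGroup (Fin 2) ℂ)) := by
    rw [← integral_mul_right_eq_self (fun g : (Matrix.specialUnitaryGroup (Fin 2) ℂ) => Real.exp (B * (g.1.trace).re)) V]
    refine integral_congr_ae (ae_of_all _ fun g => ?_)
    simp only [Submonoid.coe_mul]
  have hN : ∫ g, (2 - ((g.1 * W.1).trace).re) * Real.exp (B * ((g.1 * V.1).trace).re) ∂(haarProbability (Matrix.specialUnitaryGroup (Fin 2) ℂ)) =
      ∫ g, (2 - ((g.1 * (V⁻¹ * W).1).trace).re) * Real.exp (B * (g.1.trace).re) ∂(haarProbability (Matrix.specialUnitaryGroup (Fin 2) ℂ)) := by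
    rw [← integral_mul_right_eq_self
      (fun g : (Matrix.specialUnitaryGroup (Fin 2) ℂ) => (2 - ((g.1 * (V⁻¹ * W).1).trace).re) * Real.exp (B * (g.1.trace).re)) V]
    refine integral_congr_ae (ae_of_all _ fun g => ?_)
    have hVV : V.1 * (V⁻¹).1 = 1 := by
      rw [← Submonoid.coe_mul, mul_inv_cancel]; rfl
    have h1 : g.1 * V.1 * ((V⁻¹).1 * W.1) = g.1 * W.1 := by
      rw [← mul_assoc, mul_assoc g.1, hVV, mul_one]
    simp only [Submonoid.coe_mul, h1]
  rw [hZ, hN]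
  set M : (Matrix.specialUnitaryGroup (Fin 2) ℂ) := V⁻¹ * W with hM
  set Z : ℝ := ∫ g, Real.exp (B * (g.1.trace).re) ∂(haarProbability (Matrix.specialUnitaryGroup (Fin 2) ℂ)) with hZdef
  set T : ℝ := ∫ g, (g.1.trace).re * Real.exp (B * (g.1.trace).re) ∂(haarProbability (Matrix.specialUnitaryGroup (Fin 2) ℂ)) with hTdef
  have hT : 0 ≤ T := integral_re_trace_mul_exp_nonneg hB
  have htrM : (M.1.trace).re ≤ 2 := re_trace_le_two M
  -- expand the numerator
  have hfi1 : Integrable (fun g : (Matrix.specialUnitaryGroup (Fin 2) ℂ) => 2 * Real.exp (B * (g.1.trace).re)) (haarProbability (Matrix.specialUnitaryGroup (Fin 2) ℂ)) :=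
    integrable_of_continuous_su2 (continuous_const.mul (Real.continuous_exp.comp (continuous_const.mul continuous_re_trace)))
  have hfi2 : Integrable (fun g : (Matrix.specialUnitaryGroup (Fin 2) ℂ) => ((g.1 * M.1).trace).re * Real.exp (B * (g.1.trace).re))
      (haarProbability (Matrix.specialUnitaryGroup (Fin 2) ℂ)) :=
    integrable_of_continuous_su2 ((continuous_re_trace_mul _).mul
      (Real.continuous_exp.comp (continuous_const.mul continuous_re_trace)))
  have hexp : ∫ g, (2 - ((g.1 * M.1).trace).re) * Real.exp (B * (g.1.trace).re) ∂(haarProbability (Matrix.specialUnitaryGroup (Fin 2) ℂ)) =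
      2 * Z - (M.1.trace).re / 2 * T := by
    rw [hZdef, hTdef, ← integral_re_trace_mul_coe_mul_exp M B, ← integral_const_mul, ← integral_sub hfi1 hfi2]
    refine integral_congr_ae (ae_of_all _ fun g => ?_)
    ring
  -- the axis floor of the tree: `6 Z ≤ (4B+3) ∫ (2 − Re tr) e^{B Re tr}`, and `∫ (2 − Re tr) e = 2Z − T`
  have haxis := mul_integral_exp_le_integral_two_sub_re_trace_mul_exp hB
  have hfi3 : Integrable (fun g : (Matrix.specialUnitaryGroup (Fin 2) ℂ) => (g.1.trace).re * Real.exp (B * (g.1.trace).re))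
      (haarProbability (Matrix.specialUnitaryGroup (Fin 2) ℂ)) :=
    integrable_of_continuous_su2 (continuous_re_trace.mul (Real.continuous_exp.comp (continuous_const.mul continuous_re_trace)))
  have haxis' : ∫ g, (2 - (g.1.trace).re) * Real.exp (B * (g.1.trace).re) ∂(haarProbability (Matrix.specialUnitaryGroup (Fin 2) ℂ)) = 2 * Z - T := by
    rw [hZdef, hTdef, ← integral_const_mul, ← integral_sub hfi1 hfi3]
    refine integral_congr_ae (ae_of_all _ fun g => ?_)
    ring
  rw [haxis'] at haxis
  rw [hexp]
  have h43 : (0 : ℝ) < 4 * B + 3 := by linarith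
  rw [div_mul_eq_mul_div, div_le_iff₀ h43]
  -- `6Z ≤ (4B+3)(2Z − T) ≤ (4B+3)(2Z − (Re tr M/2) T)` since `(1 − Re tr M/2)·T ≥ 0`
  have hmono : (4 * B + 3) * (2 * Z - T) ≤ (2 * Z - (M.1.trace).re / 2 * T) * (4 * B + 3) := by
    have : 0 ≤ (1 - (M.1.trace).re / 2) * T := mul_nonneg (by linarith) hT
    nlinarith
  exact haxis.trans hmono

end Summit.QuantumFields.YangMills.Cruxes.UVSeamRec.ClassicalResponse.ThermalFloor

end
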